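import Summits.QuantumFields.YangMills.Theorems.UnitScaleTiltProp8HalvingELJunction
import Summits.QuantumFields.YangMills.Theorems.UnitScaleTiltProp8HalvingHMatrixSup
import Summits.QuantumFields.YangMills.Theorems.UnitScaleTiltProp8HalvingSiteAssembly
import Summits.QuantumFields.YangMills.Theorems.UnitScaleTiltProp8FlatCubeQContraction
import Summits.QuantumFields.YangMills.Theorems.UnitScaleTiltProp7LineAvgAdjoint
import Literature.MathematicalPhysics.QuantumFieldTheory.Balaban1983to89.B6AgreeQaQV1Chart
import HarnessLib

/-!
# Route `UnitScaleTilt`, crux K1 child «MinimiserStabilityRegPr» (stmt-QuantumFields-19200), registered stub V2′ `stub_halvingStep`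
# (skeletons v8 5b4e846794b80374 / v10 `BirthV10`) — **THE MULTIPLIER LETTER ON THE LAYER** (owner socket (σ-3), file 2): the sup size of
# `𝔐w = Q*(QGQ*)⁻¹QG·w` (print's `(1 − P₀)ᵀw`, (131)) at the bonds of the top layer, i.e. the `hMl` hypothesis of
# `HalvingA1Row165.row165_of_smallSolution_layer` (★w5-19200 g2) for the `Mv` of `HalvingELJunction.flatStencil_eq_of_slice`, from P2-type rows:
# the text's `∂*∂`-row of `H` ((161)₁ + (162)), a `G`-sup row at BAND weights `a(c) ≤ (L^{K−n})²L^{j(c)}` with the contraction row of `Q`, and the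
# exact transpose of the top-level block average (the tent field)

Cell `ym3-torus` (HUMAN RULING D-0037, YM ladder rung R3 — continuum SU(2) YM₃ on the torus is a RUNG, not the Clay problem), width seat
`ym-ust-19200-w3` gen 3 (D-0149).  `--supports stmt-QuantumFields-19200 --as helper`; def-free, 0 sorry, standard axioms.

THE PRINT ([Balaban1985Variational] p. 298): *«A₀ = −GP₀*J + … (133) … the right-hand side of (133) can be estimated by O(1)C₁B₃ε₁(Lʲη)⁻³ on Ωⱼ»* —
the operator `P₀ᵀ = 1 − Q*(QGQ*)⁻¹QG` is bounded on the `(−3)`-weighted sup norms; print takes this from the rows of `H₀ = GQ*(QGQ*)⁻¹` of [5] ((3.133), (130),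
(137)–(140) pp. 298–299).  HERE, at background 1 and on the top layer only (where the (165)-A₁ clause of the halving package lives): by `HalvingELJunction.QsE_EE_eq`
and the canonicity of `(QGQ*)⁻¹QG = Hᵀ` in the auxiliary weights `a` ([Balaban1984PropagatorsII] p. 228), `𝔐f = ∂*∂H(X) + Q*(aX)` with `X = QG_af` for ANY
positive `a`; the first term is the text's `∂*∂`-row of `H` (`FlatCubeOpsText.HDecayLetterD` row 3 + `RowSum162`, as `HalvingHMatrixSup.rowsSup_real`) on the datum
`(Lʲ⁽ᶜ⁾η)|X(c)| ≤ C_Q·C_G·β` (a `G_a`-sup row `GtSupLetterG` ∘ `QContrLetter`); the second is the TRANSPOSE of the top-level block average — at a top-layer bond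
only top-level index bonds see it (lower-level contours stay in non-deep blocks, `FlatCubeQContraction.abs_bondAvgIter_le_of_blocks`), and the transpose of
`Q_k` is the tent field of `Prop7LineAvgAdjoint` with `|Q_kᵀμ| ≤ L^{−3k}max|μ|` (`Prop7LineAvgRightInverse.adjField_abs_le`) — against `|a(c)X(c)| ≤ C_QC_Gβ·L^{3(K−n)}`
for band weights.

WHAT THIS FILE PROVES (no definition, no sorry):
* §1 (model, every `D : Domains P`): `EE_QE_GE_eq_of_weights` (`(QGQ*)⁻¹QG` does not depend on `a`), **`QsE_EE_QE_GE_eq_of_weights`**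
  (`Q*(QG₁Q*)⁻¹QG₁φ = ∂*∂H(QG_aφ) + Q*(a·QG_aφ)` for any two weight families).
* §2 (every `D : Domains P`): `QsE_apply_eq_sum` (`(Q*ω)(b) = Σ_c ω(c)·(Q e_b)(c)`), `bondAvgIter_single_eq_zero_of_deep` (a contour of a non-deep coarse bond
  misses a fine bond in a deep block), **`abs_QsE_apply_le_of_top`** (`|(Q*ω)(b)| ≤ L^{−d·k}·max_{top c}|ω(c)|` at a fine bond `b` of the top region).
* §3 (T³ carrier): **`multiplierLetter_real`** (`|𝔐f(b)| ≤ (B₀B₃ + 1)C_QC_G·β` at a bond with `w₁(b) = w₃(b) = 1` in the top region, from the displayed rows),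
  **`multiplierLetter_matrix`** (the same for `𝔤`-valued currents through the kernel extension, no component loss), **`multiplierLetter_layer`** (at the cube
  sequence `cubeSeqMT3 … x ρ S M`, `ρ ≥ 1`: LITERALLY the `hMl` shape of `row165_of_smallSolution_layer` for `Mv f b := Σ_{b′} (𝔐e_{b′})(b)•f(b′)`).
HONEST SCOPE.  Bookkeeping over displayed rows: the `H`-rows and `RowSum162` are the P2 text's (✓ `FlatPortBodyL0.body_of_adm22`, odd `L ≥ 5`), the `G`-row AT BAND
WEIGHTS with the band displayed is the port's `FlatPortKernelRowsL0.kernelRowsAt_domT` construction (its weights `w♯(c) = (L^{K−n}/L^{j(c)})²(L^{j(c)})³`; the registered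
`RowsAt` hides them behind `∃` — a port-level re-export is the open supplier), `QContrLetter` is ✓ `FlatCubeQContraction.qContrLetter_of_adm22`.  NOT a claim about
the crux, the rung, or the mass gap.

References: T. Bałaban, CMP **102** (1985) 277–309 [Balaban1985Variational] (131)–(133) p.298, (161)–(163) p.303, (165) p.304; CMP **96** (1984) 223–250
[Balaban1984PropagatorsII] (2.16) p.225, (2.19)–(2.22) p.226, (2.35) p.228; CMP **95** (1984) 17–40 [Balaban1984PropagatorsI] (1.11) p.19, (1.18) p.20.
-/

set_option autoImplicit false

noncomputable section

open scoped BigOperators InnerProductSpace Matrix.Norms.L2Operator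

namespace Summit.QuantumFields.YangMills.Theorems.HalvingMultiplierLetter

open Literature.MathematicalPhysics.QuantumFieldTheory.Balaban1983to89
open Literature.MathematicalPhysics.QuantumFieldTheory.BalabanImbrieJaffe1984to88.BIJ85AxialPropagator411 (BondSpace PlaqSpace)
open B6SectADomainsV1 (Domains)
open B6SectAOperatorsV1 (BondIdx BondIdxSpace QE QsE RE dsE dcE dcsE aE inner_eq_sum inner_QsE_left QE_apply aE_apply)
open B6SectAVectorModelV1 (GE EE inner_GE_left)
open B6SectA (hOp)
open B6AgreeQaQV1Chart (wxG sum_bondIdx_levels wxG_of_not_lam)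
open B5Eq118OneStroke (iterBlockOf)
open B5Eq117TorusCarriers (Mk)
open B5Prop12FieldsLattice (distSite)
open B8Ineq132 (BondTouches)
open B8Thm2SetupTorus (pullDom)
open B10Eq27TorusAxialLog (transl)
open LatticeFieldCalculus (bondAvgIter)
open T3ContinuumYM3Torus (T3Family)
open FlatCubeOperators (hOp_eq_hOp inner_EE_left hOp_apply)
open FlatCubeOpsText (IsLevWeight HDecayLetterD RowSum162 GtSupLetterG)
open FlatOpsLettersAssembly (flatH Qfun Qfun_apply IsFlatGW QContrLetter)
open FlatCubeQContraction (abs_bondAvgIter_le_of_blocks)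
open FlatCubeSequenceAligned (cubeSeqMT3)
open HalvingELJunction (QsE_EE_eq linear_kernel)
open HalvingQuarterMatrix (norm_le_of_forall_reFunctional)
open HalvingQuarterCubeSeq (levWeight_eq_one_of_inOm_top inOm_top_of_dist)
open HalvingSiteAssembly (distSite_iterBlockOf_le_one_of_le_one dist_le_one_of_bondTouches)
open HalvingHMatrixSup (rowsSup_real)

/-! ## §1 `(QGQ*)⁻¹QG` is canonical; the multiplier operator at two weight families -/

section Model

variable {P : Params} (D : Domains P) {c : ℝ} (hc : c ≠ 0) {w w' : BondIdx D → ℝ} (hw : ∀ i, 0 < w i) (hw' : ∀ i, 0 < w' i)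

/-- **`(QGQ*)⁻¹QG` DOES NOT DEPEND ON THE WEIGHTS `a`**: it is the transpose of the canonical `H = GQ*(QGQ*)⁻¹` (p. 228 «The only assumption we have used was the
positivity of the operator Δ_a»; `FlatCubeOperators.hOp_eq_hOp`). [cite: Balaban1984PropagatorsII, (2.35) p.228] -/
theorem EE_QE_GE_eq_of_weights (φ : BondSpace P) :
    EE D hc hw (QE D (GE D hc hw φ)) = EE D hc hw' (QE D (GE D hc hw' φ)) := by
  have key : ∀ {v : BondIdx D → ℝ} (hv : ∀ i, 0 < v i) (β : BondIdxSpace D),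
      ⟪β, EE D hc hv (QE D (GE D hc hv φ))⟫_ℝ = ⟪hOp (GE D hc hv) (QsE D) (EE D hc hv) β, φ⟫_ℝ := by
    intro v hv β
    rw [← inner_EE_left D hc hv, ← inner_QsE_left, hOp_apply, inner_GE_left]
  refine ext_inner_left ℝ fun β => ?_
  rw [key hw, key hw', hOp_eq_hOp D hc hw hw']

/-- **THE MULTIPLIER OPERATOR AT TWO WEIGHT FAMILIES**: `Q*(QG₁Q*)⁻¹QG₁φ = ∂*∂H(QG_aφ) + Q*(a·QG_aφ)` — the left side at the weights `w` (the pinned ones), the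
right side at ANY positive weights `w′` (`H` canonical). [cite: Balaban1985Variational, (131)-(133) p.298; Balaban1984PropagatorsII, (2.35) p.228] -/
theorem QsE_EE_QE_GE_eq_of_weights (φ : BondSpace P) :
    QsE D (EE D hc hw (QE D (GE D hc hw φ))) =
      dcsE c (dcE c (hOp (GE D hc hw) (QsE D) (EE D hc hw) (QE D (GE D hc hw' φ)))) + QsE D (aE D w' (QE D (GE D hc hw' φ))) := by
  rw [EE_QE_GE_eq_of_weights D hc hw hw' φ, QsE_EE_eq D hc hw' (QE D (GE D hc hw' φ)), hOp_eq_hOp D hc hw' hw]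

end Model

/-! ## §2 The transpose of the block averages at a fine bond of the top region -/

section Transpose

variable {P : Params} (D : Domains P)

/-- **`(Q*ω)(b) = Σ_c ω(c)·(Q e_b)(c)`** — the `ℓ²`-adjoint of the multi-scale `Q` read on the indicator of a fine bond. [cite: Balaban1984PropagatorsII, (2.18)-(2.20) p.226] -/
theorem QsE_apply_eq_sum (ω : BondIdxSpace D) (b : PBond P 0) :
    QsE D ω b = ∑ c : BondIdx D, ω c * bondAvgIter (c.1.1 : ℕ) (Pi.single b (1 : ℝ)) c.1.2 := by
  have h := inner_QsE_left (D := D) ω (EuclideanSpace.single b (1 : ℝ))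
  rw [EuclideanSpace.inner_single_right] at h
  simp only [one_mul, conj_trivial] at h
  rw [h, inner_eq_sum]
  refine Finset.sum_congr rfl fun c _ => ?_
  rw [QE_apply, PiLp.ofLp_single]

/-- **A CONTOUR OF A NON-DEEP COARSE BOND MISSES EVERY FINE BOND OF A DEEP BLOCK**: for a `j`-bond `β` with `β₋, β₊` not deep and a fine bond `b` whose `j`-block
is deep (`Bʲ(b₋) ∈ B⁻¹(Ω_{j+1})`), `(Q_je_b)(β) = 0` ((1.11)/(1.18): the contours `[x, x(β)]` lie in `B(β₋) ∪ B(β₊)`). [cite: Balaban1984PropagatorsI, (1.11) p.19, (1.18) p.20; Balaban1984PropagatorsII, (2.3)-(2.4) p.224] -/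
theorem bondAvgIter_single_eq_zero_of_deep {j : ℕ} (hj : j ≤ P.m + P.K) (β : PBond P j) (hs : ¬ D.Deep j β.src) (ht : ¬ D.Deep j β.tgt)
    (b : PBond P 0) (hb : D.Deep j (iterBlockOf j b.src)) : bondAvgIter j (Pi.single b (1 : ℝ)) β = 0 := by
  have h := abs_bondAvgIter_le_of_blocks (P := P) j hj {y : Site P j | y = β.src ∨ y = β.tgt} (Pi.single b (1 : ℝ)) 0
    (fun b' hb's _ => by
      by_cases hbb : b' = b
      · subst hbb
        exfalso
        rcases hb's with h | h
        · exact hs (h ▸ hb)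
        · exact ht (h ▸ hb)
      · rw [Pi.single_eq_of_ne hbb, abs_zero])
    β (Or.inl rfl) (Or.inr rfl)
  exact abs_nonpos_iff.1 h

/-- **THE TRANSPOSE AT A FINE BOND OF THE TOP REGION**: if `B^k(b₋) ∈ Ω_k` (so every lower block of `b₋` is deep) and `|ω(c)| ≤ B` on the TOP-level index bonds,
then `|(Q*ω)(b)| ≤ (L^k)^{−d}·B` — only the top level sees `b`, and there `Q_kᵀ` is the tent field of the two blocks behind `b` with total weight `L^{−kd}`.
[cite: Balaban1984PropagatorsI, (1.18) p.20; Balaban1984PropagatorsII, (2.20) p.226] -/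
theorem abs_QsE_apply_le_of_top (ω : BondIdxSpace D) {b : PBond P 0} (hb : D.InOm D.k b.src) {B : ℝ} (hB : 0 ≤ B)
    (hω : ∀ c : BondIdx D, (c.1.1 : ℕ) = D.k → |ω c| ≤ B) :
    |QsE D ω b| ≤ (((P.L : ℝ) ^ D.k) ^ P.d)⁻¹ * B := by
  classical
  have hk : D.k ≤ P.m + P.K := D.hk
  rw [QsE_apply_eq_sum]
  -- level by level
  have hlev := sum_bondIdx_levels D (fun c => ω c) (fun n β y => y * bondAvgIter n (Pi.single b (1 : ℝ)) β) (fun n β => zero_mul _)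
  simp only at hlev
  rw [hlev, Finset.sum_range_succ, Finset.sum_eq_zero, zero_add]
  · -- the top level: the tent field of the zero-extended datum
    set μc : PBond P D.k → ℝ := fun β => wxG D (fun c => ω c) D.k β with hμc
    have hμB : ∀ β, |μc β| ≤ B := by
      intro β
      show |wxG D (fun c => ω c) D.k β| ≤ B
      by_cases hβ : D.LamBond D.k β
      · have := hω ⟨⟨⟨D.k, Nat.lt_succ_self _⟩, β⟩, hβ⟩ rfl
        rwa [B6AgreeQaQV1Chart.wxG_of_lam D _ (Nat.lt_succ_self _) hβ]
      · rw [wxG_of_not_lam D _ hβ, abs_zero]; exact hB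
    have hsp := Prop7FlatCoercivity.sitesPerDir_zero_eq_pow_mul (P := P) hk
    -- the tent field of `μc`
    set A : PBond P 0 → ℝ := fun b' => (((P.L : ℝ) ^ D.k) ^ P.d * (P.L : ℝ) ^ D.k)⁻¹ *
      (((((b'.src b'.dir).val % P.L ^ D.k : ℕ) : ℝ) + 1) * μc ⟨Site.proj D.k D.k b'.src, b'.dir⟩
        + ((P.L ^ D.k - 1 - (b'.src b'.dir).val % P.L ^ D.k : ℕ) : ℝ) * μc ⟨(Site.proj D.k D.k b'.src).unshift b'.dir, b'.dir⟩) with hA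
    have hAeq : ∀ b', A b' = _ := fun b' => rfl
    have htr := Prop7LineAvgAdjoint.sum_adjField_mul_eq_bondAvgIter hsp μc A hAeq hk (Pi.single b (1 : ℝ))
    rw [Finset.sum_eq_single b (fun b' _ hb' => by rw [Pi.single_eq_of_ne hb', mul_zero]) (fun h => absurd (Finset.mem_univ _) h),
      Pi.single_eq_same, mul_one] at htr
    rw [← htr]
    exact Prop7LineAvgRightInverse.adjField_abs_le μc A hAeq hμB b
  · -- lower levels vanish
    intro n hn
    have hn' : n < D.k := Finset.mem_range.1 hn
    refine Finset.sum_eq_zero fun β _ => ?_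
    by_cases hβ : D.LamBond n β
    · rw [bondAvgIter_single_eq_zero_of_deep D (le_trans hn'.le hk) β hβ.2.1 hβ.2.2 b
        ((D.deep_iterBlockOf_iff n b.src).2 (D.inOm_of_le (Nat.succ_le_of_lt hn') hb)), mul_zero]
    · rw [wxG_of_not_lam D _ hβ, zero_mul]

end Transpose

/-! ## §3 The multiplier letter at the T³ carrier -/

section Carrier

variable {F : T3Family} {n K : ℕ} {D : Domains (F.P K)}

/-- `L^{(K−n)−j} = (L^j·(L⁻¹)^{K−n})⁻¹` for `j ≤ K − n` (the datum weight of the text's `H`-letters). [folklore] -/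
theorem pow_sub_eq_inv (hL : (0 : ℝ) < (F.L : ℝ)) {j : ℕ} (hj : j ≤ K - n) :
    (F.L : ℝ) ^ ((K - n) - j) = ((F.L : ℝ) ^ j * ((F.L : ℝ)⁻¹) ^ (K - n))⁻¹ := by
  rw [inv_pow, mul_inv, inv_inv, pow_sub₀ _ hL.ne' hj, mul_comm]

/-- **THE MULTIPLIER LETTER, REAL CURRENTS**: at a fine bond `b` of the top region with `w₁(b) = w₃(b) = 1`, for a current with `w₃|f| ≤ β`,
`|𝔐f(b)| ≤ (B₀B₃ + 1)·C_Q·C_G·β`, `𝔐 = Q*(QGQ*)⁻¹QG` pinned at `a ≡ 1`, GIVEN: the text's `∂*∂`-row of `H` with its (162) row sum (`HDecayLetterD`, `RowSum162` over a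
nonnegative `dBI`), a `G_a`-sup row `GtSupLetterG` at band weights `a(c) ≤ (L^{K−n})²L^{j(c)}`, and the contraction row of `Q`.
[cite: Balaban1985Variational, (131)-(133) p.298, (161)-(162) p.303, (165) p.304; Balaban1984PropagatorsII, (2.16) p.225, (2.35) p.228] -/
theorem multiplierLetter_real (hDk : D.k = K - n) {dBI : PBond (F.P K) 0 → BondIdx D → ℝ} {w : ℕ → PBond (F.P K) 0 → ℝ}
    {δ₀ B₀ B₃ CG CQ : ℝ} (hH : HDecayLetterD F n K D dBI w (flatH F n K D) B₀ δ₀) (h162 : RowSum162 F n K D dBI w δ₀ B₃)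
    (hδ₀ : 0 ≤ δ₀) (hB₀ : 0 ≤ B₀) (hd : ∀ b c, 0 ≤ dBI b c)
    {w' : BondIdx D → ℝ} (hw' : ∀ i, 0 < w' i) {G : (PBond (F.P K) 0 → ℝ) →ₗ[ℝ] (PBond (F.P K) 0 → ℝ)} (hGW : IsFlatGW F n K D hw' G)
    (hGsup : GtSupLetterG F n K w G CG) (hband : ∀ c : BondIdx D, w' c ≤ ((F.L : ℝ) ^ (K - n)) ^ 2 * (F.L : ℝ) ^ (c.1.1 : ℕ))
    (hQ : QContrLetter F n K D w CQ) (hCG : 0 ≤ CG) (hCQ : 0 ≤ CQ)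
    (Mop : (PBond (F.P K) 0 → ℝ) →ₗ[ℝ] (PBond (F.P K) 0 → ℝ))
    (hMop : ∀ (f : PBond (F.P K) 0 → ℝ) (b : PBond (F.P K) 0),
      Mop f b = QsE D (EE D (c := (F.L : ℝ) ^ (K - n)) (pow_ne_zero _ (Nat.cast_ne_zero.2 (F.P K).L_pos.ne')) (w := fun _ => (1 : ℝ))
        (fun _ => one_pos) (QE D (GE D (c := (F.L : ℝ) ^ (K - n)) (pow_ne_zero _ (Nat.cast_ne_zero.2 (F.P K).L_pos.ne')) (w := fun _ => (1 : ℝ))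
        (fun _ => one_pos) (WithLp.toLp 2 f)))) b)
    {f : PBond (F.P K) 0 → ℝ} {β : ℝ} (hβ : 0 ≤ β) (hf : ∀ b, w 3 b * |f b| ≤ β)
    {b : PBond (F.P K) 0} (hb1 : w 1 b = 1) (hb3 : w 3 b = 1) (hbtop : D.InOm (K - n) b.src) :
    |Mop f b| ≤ (B₀ * B₃ + 1) * CQ * CG * β := by
  have hc : ((F.L : ℝ) ^ (K - n)) ≠ 0 := pow_ne_zero _ (Nat.cast_ne_zero.2 (F.P K).L_pos.ne')
  have hL0 : (0 : ℝ) < (F.L : ℝ) := by exact_mod_cast lt_trans zero_lt_one F.hL.2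
  set t : ℝ := CQ * CG * β with ht
  have ht0 : 0 ≤ t := by positivity
  -- the multiplier datum `X = Q(G_a f)` and its size
  set X : BondIdx D → ℝ := Qfun D (G f) with hX
  have hGf := (hGsup f β hβ hf).1
  have hQX := hQ (G f) (CG * β) (by positivity) hGf
  have hXt : ∀ c : BondIdx D, |X c| ≤ t * (F.L : ℝ) ^ ((K - n) - (c.1.1 : ℕ)) := by
    intro c
    have hj : (c.1.1 : ℕ) ≤ K - n := by have := Nat.lt_succ_iff.1 c.1.1.isLt; omega
    have hpos : (0 : ℝ) < (F.L : ℝ) ^ (c.1.1 : ℕ) * ((F.L : ℝ)⁻¹) ^ (K - n) := by positivity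
    rw [pow_sub_eq_inv hL0 hj, ← div_eq_mul_inv, le_div_iff₀ hpos, mul_comm]
    have h := hQX c
    rw [ht]
    linarith
  -- `G f` is `G_a f`, `X` is `Q(G_a f)`
  have hGf' : WithLp.toLp 2 (G f) = GE D hc hw' (WithLp.toLp 2 f) := by
    ext b'
    exact hGW f b'
  have hXE : QE D (GE D hc hw' (WithLp.toLp 2 f)) = WithLp.toLp 2 X := by
    rw [← hGf']
    ext c'
    rfl
  -- `𝔐f = ∂*∂H(X) + Q*(aX)`
  have hdec := QsE_EE_QE_GE_eq_of_weights D hc (fun _ => one_pos) hw' (WithLp.toLp 2 f)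
  rw [hXE] at hdec
  have hHX : hOp (GE D hc (w := fun _ => (1 : ℝ)) (fun _ => one_pos)) (QsE D) (EE D hc (w := fun _ => (1 : ℝ)) (fun _ => one_pos))
      (WithLp.toLp 2 X) = WithLp.toLp 2 (flatH F n K D X) := by
    ext b'
    rfl
  have hMb : Mop f b = dcsE ((F.L : ℝ) ^ (K - n)) (dcE ((F.L : ℝ) ^ (K - n)) (WithLp.toLp 2 (flatH F n K D X))) b +
      QsE D (aE D w' (WithLp.toLp 2 X)) b := by
    rw [hMop f b, hdec, hHX, PiLp.add_apply]
  -- term 1: the text's `∂*∂`-row of `H` on the datum `X`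
  have h1 := (rowsSup_real hH h162 hδ₀ hB₀ ht0 (hd b) (by rw [hb1]; exact zero_le_one) hXt).2.2.1
  rw [hb1, hb3, one_mul, one_mul] at h1
  -- term 2: the transpose of the top-level average against the band-weighted datum
  have hωB : ∀ c : BondIdx D, (c.1.1 : ℕ) = D.k → |aE D w' (WithLp.toLp 2 X) c| ≤ ((F.L : ℝ) ^ (K - n)) ^ 3 * t := by
    intro c hck
    rw [aE_apply, abs_mul, abs_of_pos (hw' c)]
    have hXc := hXt c
    rw [hck, hDk, Nat.sub_self, pow_zero, mul_one] at hXc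
    have hwc := hband c
    rw [hck, hDk] at hwc
    calc w' c * |(WithLp.toLp 2 X : BondIdxSpace D) c| ≤ (((F.L : ℝ) ^ (K - n)) ^ 2 * (F.L : ℝ) ^ (K - n)) * t :=
          mul_le_mul hwc hXc (abs_nonneg _) (by positivity)
      _ = ((F.L : ℝ) ^ (K - n)) ^ 3 * t := by ring
  have h2 := abs_QsE_apply_le_of_top D (aE D w' (WithLp.toLp 2 X)) (b := b) (by rw [hDk]; exact hbtop) (by positivity) hωB
  rw [hDk, T3Family.P_d] at h2
  have hLk : (0 : ℝ) < ((F.L : ℝ) ^ (K - n)) ^ 3 := by positivity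
  have h2' : |QsE D (aE D w' (WithLp.toLp 2 X)) b| ≤ t := by
    calc |QsE D (aE D w' (WithLp.toLp 2 X)) b| ≤ (((F.L : ℝ) ^ (K - n)) ^ 3)⁻¹ * (((F.L : ℝ) ^ (K - n)) ^ 3 * t) := h2
      _ = t := by field_simp
  -- assemble
  rw [hMb]
  calc |dcsE ((F.L : ℝ) ^ (K - n)) (dcE ((F.L : ℝ) ^ (K - n)) (WithLp.toLp 2 (flatH F n K D X))) b + QsE D (aE D w' (WithLp.toLp 2 X)) b|
      ≤ |dcsE ((F.L : ℝ) ^ (K - n)) (dcE ((F.L : ℝ) ^ (K - n)) (WithLp.toLp 2 (flatH F n K D X))) b| + |QsE D (aE D w' (WithLp.toLp 2 X)) b| :=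
        abs_add_le _ _
    _ ≤ B₀ * B₃ * t + t := add_le_add h1 h2'
    _ = (B₀ * B₃ + 1) * CQ * CG * β := by rw [ht]; ring

/-- **THE MULTIPLIER LETTER FOR `𝔤`-VALUED CURRENTS** (no component loss): under the rows of `multiplierLetter_real`, for a matrix current with `w₃‖f‖ ≤ β` and the
kernel extension `ℳ(b) = Σ_{b′} (𝔐e_{b′})(b)·f(b′)`, at a bond `b` of the top region with `w₁(b) = w₃(b) = 1`: `‖ℳ(b)‖ ≤ (B₀B₃ + 1)C_QC_G·β`.
[cite: Balaban1985Variational, (131)-(133) p.298, (165) p.304] -/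
theorem multiplierLetter_matrix (hDk : D.k = K - n) {dBI : PBond (F.P K) 0 → BondIdx D → ℝ} {w : ℕ → PBond (F.P K) 0 → ℝ}
    {δ₀ B₀ B₃ CG CQ : ℝ} (hH : HDecayLetterD F n K D dBI w (flatH F n K D) B₀ δ₀) (h162 : RowSum162 F n K D dBI w δ₀ B₃)
    (hδ₀ : 0 ≤ δ₀) (hB₀ : 0 ≤ B₀) (hB₃ : 0 ≤ B₃) (hd : ∀ b c, 0 ≤ dBI b c) (hw3 : ∀ b, 0 ≤ w 3 b)
    {w' : BondIdx D → ℝ} (hw' : ∀ i, 0 < w' i) {G : (PBond (F.P K) 0 → ℝ) →ₗ[ℝ] (PBond (F.P K) 0 → ℝ)} (hGW : IsFlatGW F n K D hw' G)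
    (hGsup : GtSupLetterG F n K w G CG) (hband : ∀ c : BondIdx D, w' c ≤ ((F.L : ℝ) ^ (K - n)) ^ 2 * (F.L : ℝ) ^ (c.1.1 : ℕ))
    (hQ : QContrLetter F n K D w CQ) (hCG : 0 ≤ CG) (hCQ : 0 ≤ CQ)
    (Mop : (PBond (F.P K) 0 → ℝ) →ₗ[ℝ] (PBond (F.P K) 0 → ℝ))
    (hMop : ∀ (f : PBond (F.P K) 0 → ℝ) (b : PBond (F.P K) 0),
      Mop f b = QsE D (EE D (c := (F.L : ℝ) ^ (K - n)) (pow_ne_zero _ (Nat.cast_ne_zero.2 (F.P K).L_pos.ne')) (w := fun _ => (1 : ℝ))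
        (fun _ => one_pos) (QE D (GE D (c := (F.L : ℝ) ^ (K - n)) (pow_ne_zero _ (Nat.cast_ne_zero.2 (F.P K).L_pos.ne')) (w := fun _ => (1 : ℝ))
        (fun _ => one_pos) (WithLp.toLp 2 f)))) b)
    {f ℳ : PBond (F.P K) 0 → Matrix (Fin 2) (Fin 2) ℂ} {β : ℝ} (hβ : 0 ≤ β) (hf : ∀ b, w 3 b * ‖f b‖ ≤ β)
    (hℳ : ∀ b, ℳ b = ∑ b', Mop (Pi.single b' 1) b • f b')
    {b : PBond (F.P K) 0} (hb1 : w 1 b = 1) (hb3 : w 3 b = 1) (hbtop : D.InOm (K - n) b.src) :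
    ‖ℳ b‖ ≤ (B₀ * B₃ + 1) * CQ * CG * β := by
  have hq : 0 ≤ (B₀ * B₃ + 1) * CQ * CG * β := by positivity
  refine norm_le_of_forall_reFunctional (ℳ b) hq fun fd u r hg => ?_
  have hker : r * (u * fd (ℳ b)).re = Mop (fun i => r * (u * fd (f i)).re) b :=
    HalvingGtMatrix.reFunctional_kernel' Mop hℳ fd u r b
  have hf' : ∀ b', w 3 b' * |(fun i => r * (u * fd (f i)).re) b'| ≤ β :=
    fun b' => (mul_le_mul_of_nonneg_left (hg (f b')) (hw3 b')).trans (hf b')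
  have hreal : |Mop (fun i => r * (u * fd (f i)).re) b| ≤ (B₀ * B₃ + 1) * CQ * CG * β :=
    multiplierLetter_real hDk hH h162 hδ₀ hB₀ hd hw' hGW hGsup hband hQ hCG hCQ Mop hMop hβ hf' hb1 hb3 hbtop
  rw [hker]
  exact le_trans (le_abs_self (Mop (fun i => r * (u * fd (f i)).re) b)) hreal

/-- **THE MULTIPLIER LETTER ON THE LAYER AT THE CUBE SEQUENCE** — LITERALLY the `hMl` hypothesis of `HalvingA1Row165.row165_of_smallSolution_layer` for
`Mv f b := Σ_{b′} (𝔐e_{b′})(b)·f(b′)` with `B_M = (B₀B₃ + 1)C_QC_G`: at the cube sequence `cubeSeqMT3 F n K x ρ S M` (`ρ ≥ 1`) with its level weights, for every matrix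
current with `w₃‖f‖ ≤ β` and every bond of the top layer around `x`, `‖Mv f ⟨0 + z, μ⟩‖ ≤ B_M·β` (there the weights are `1` and the `(K−n)`-block of the bond lies
in `□_k`). [cite: Balaban1985Variational, (131)-(133) p.298, (144) p.300, (165) p.304] -/
theorem multiplierLetter_layer (hnK : n < K) (x : Site (F.P K) 0) (ρ S M : ℕ) (hM : 1 ≤ M) (hρ1 : 1 ≤ ρ)
    {w : ℕ → PBond (F.P K) 0 → ℝ} (hw : IsLevWeight F n K (cubeSeqMT3 F n K x ρ S M hM) w)
    {dBI : PBond (F.P K) 0 → BondIdx (cubeSeqMT3 F n K x ρ S M hM) → ℝ} {δ₀ B₀ B₃ CG CQ : ℝ}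
    (hH : HDecayLetterD F n K (cubeSeqMT3 F n K x ρ S M hM) dBI w (flatH F n K (cubeSeqMT3 F n K x ρ S M hM)) B₀ δ₀)
    (h162 : RowSum162 F n K (cubeSeqMT3 F n K x ρ S M hM) dBI w δ₀ B₃)
    (hδ₀ : 0 ≤ δ₀) (hB₀ : 0 ≤ B₀) (hB₃ : 0 ≤ B₃) (hd : ∀ b c, 0 ≤ dBI b c)
    {w' : BondIdx (cubeSeqMT3 F n K x ρ S M hM) → ℝ} (hw' : ∀ i, 0 < w' i)
    {G : (PBond (F.P K) 0 → ℝ) →ₗ[ℝ] (PBond (F.P K) 0 → ℝ)} (hGW : IsFlatGW F n K (cubeSeqMT3 F n K x ρ S M hM) hw' G)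
    (hGsup : GtSupLetterG F n K w G CG)
    (hband : ∀ c : BondIdx (cubeSeqMT3 F n K x ρ S M hM), w' c ≤ ((F.L : ℝ) ^ (K - n)) ^ 2 * (F.L : ℝ) ^ (c.1.1 : ℕ))
    (hQ : QContrLetter F n K (cubeSeqMT3 F n K x ρ S M hM) w CQ) (hCG : 0 ≤ CG) (hCQ : 0 ≤ CQ)
    (Mop : (PBond (F.P K) 0 → ℝ) →ₗ[ℝ] (PBond (F.P K) 0 → ℝ))
    (hMop : ∀ (f : PBond (F.P K) 0 → ℝ) (b : PBond (F.P K) 0),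
      Mop f b = QsE (cubeSeqMT3 F n K x ρ S M hM) (EE (cubeSeqMT3 F n K x ρ S M hM) (c := (F.L : ℝ) ^ (K - n))
        (pow_ne_zero _ (Nat.cast_ne_zero.2 (F.P K).L_pos.ne')) (w := fun _ => (1 : ℝ)) (fun _ => one_pos)
        (QE (cubeSeqMT3 F n K x ρ S M hM) (GE (cubeSeqMT3 F n K x ρ S M hM) (c := (F.L : ℝ) ^ (K - n))
        (pow_ne_zero _ (Nat.cast_ne_zero.2 (F.P K).L_pos.ne')) (w := fun _ => (1 : ℝ)) (fun _ => one_pos) (WithLp.toLp 2 f)))) b) :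
    ∀ (f : PBond (F.P K) 0 → Matrix (Fin 2) (Fin 2) ℂ) (β : ℝ), (∀ b, w 3 b * ‖f b‖ ≤ β) →
      ∀ (z : B7Prop1Explicit.Site (F.P K).d) (μ : Fin (F.P K).d),
        BondTouches (pullDom (fun j => if K - n ≤ j then ({x} : Set (Site (F.P K) 0)) else (∅ : Set (Site (F.P K) 0))) (K - n)) z μ →
        ‖∑ b', Mop (Pi.single b' 1) ⟨transl 0 z, μ⟩ • f b'‖ ≤ (B₀ * B₃ + 1) * CQ * CG * β := by
  intro f β hf z μ hz
  have hkm : K - n ≤ (F.P K).m + (F.P K).K := FlatMinimizerH.le_T3 F n K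
  have hρ1' : (1 : ℝ) ≤ (ρ : ℝ) := by exact_mod_cast hρ1
  -- the bond lies one block from `Bᵏ(x)`: top region, weights `1`
  have hdist := dist_le_one_of_bondTouches x (K - n) hz
  have hblk := distSite_iterBlockOf_le_one_of_le_one hkm hdist
  have htop : (cubeSeqMT3 F n K x ρ S M hM).InOm (K - n) (⟨transl 0 z, μ⟩ : PBond (F.P K) 0).src :=
    inOm_top_of_dist hnK x ρ S M hM (b := (⟨transl 0 z, μ⟩ : PBond (F.P K) 0)) hblk hρ1'
  have hw1 : ∀ m, w m ⟨transl 0 z, μ⟩ = 1 := fun m => levWeight_eq_one_of_inOm_top rfl hw htop m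
  have hw3 : ∀ b, 0 ≤ w 3 b := fun b => by rw [hw 3 b]; positivity
  have hβ : 0 ≤ β := by
    have h := hf ⟨transl 0 z, μ⟩
    rw [hw1 3, one_mul] at h
    exact (norm_nonneg _).trans h
  exact multiplierLetter_matrix rfl hH h162 hδ₀ hB₀ hB₃ hd hw3 hw' hGW hGsup hband hQ hCG hCQ Mop hMop hβ hf (fun _ => rfl) (hw1 1) (hw1 3) htop

end Carrier

end Summit.QuantumFields.YangMills.Theorems.HalvingMultiplierLetter

end
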